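import Summits.CriticalPhenomena.PercolationContinuityZ3.Theorems.PercAnnulusCrossingIICSchemeScales
import HarnessLib

/-!
# Kesten–Basu–Sapozhnikov IIC scheme in boxes, NEAR-CRITICAL series IX: choice of the scales along an ABSTRACT admissibility predicate
# (lane RSW3, p1 gen 6)

builds on p205010 (kernel theorem, internal audit signed; external expert review pending)

Seat `prim-rsw3-p1` (gen 6).  Part XVIII′ (`PercAnnulusCrossingIICAspectSchemeScales.lean`) chooses the scales of Kesten's scheme inside-out so
that every junk term `α_p(σ M₁, σ M₂)` is `≤ δ`, using `θ(p) = 0`.  Here the same induction is run for an ABSTRACT predicate `good a b` on index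
pairs ("the junk at the index pair `(a,b)` is small — for all the edge densities under consideration"), under the sole hypothesis that for every
inner index `a` and bound `B` some outer index `b ≥ max B 1` is good.  Instances: `good a b := (α_p(σ a, σ b) ≤ δ)` (part XVIII′, `θ(p) = 0`) and
`good a b := (∀ p ∈ S, √P_p(NONUNIQ(σ a, σ b)) ≤ δ)` (series VIII `exists_forall_sqrt_real_nonuniq_le`: uniqueness at every `p`, uniformly
on a compact `S ⊂ [0,1)`).  Purely combinatorial; proof = part XVIII′ verbatim.  Helper file; no definitions, no sorries.
* **`exists_scheme_scales_of_good`** — scale functions `M1 M2 μ1 μ2` (scheme-level indexed, `0` outermost) with `1 ≤ M1 l ≤ M2 l`,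
  `τ (M1 l) < σ (M2 l)`, `good (M1 l) (M2 l)` (`l ≤ L`), `τ (σ (M2 (l+1)) + 1) + 2 ≤ σ (μ1 l)`, `τ (μ1 l) < σ (μ2 l)`, `μ2 l ≤ M1 l`,
  `good (μ1 l) (μ2 l)` (`l < L`), and `a₀ ≤ σ (M1 L)`.
References: H. Kesten, PTRF 73 (1986) §2; D. Basu, A. Sapozhnikov, ECP 22 (2017) no. 26, §2 (scales `N_{i+1} > 4 N_i` with `ε_i → 0`).
-/

noncomputable section

namespace Summit.CriticalPhenomena.PercolationContinuityZ3.Theorems.Crossing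

open MeasureTheory Filter Topology Literature.Probability.Percolation Literature.Probability.LatticeModels
open Literature.Probability.Percolation.DCT16
open Summit.CriticalPhenomena.PercolationContinuityZ3.Theorems.SurfaceTension
open scoped Literature.Probability.Percolation

/-- **Scales for Kesten's scheme along an abstract admissibility predicate**: see the module docstring. [cite: Kesten1986, §2]
[cite: BasuSapozhnikov2017ECP, §2 (choice of the scales N_i)] -/
theorem exists_scheme_scales_of_good {σ τ : ℕ → ℕ} (hσ : ∀ m : ℕ, 1 ≤ m → m < σ m) (hστ : ∀ m : ℕ, 1 ≤ m → σ m < τ m)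
    (good : ℕ → ℕ → Prop) (hgood : ∀ a B : ℕ, ∃ b : ℕ, B ≤ b ∧ 1 ≤ b ∧ good a b) (a₀ L : ℕ) :
    ∃ M1 M2 μ1 μ2 : ℕ → ℕ,
      (∀ l ≤ L, 1 ≤ M1 l ∧ M1 l ≤ M2 l ∧ τ (M1 l) < σ (M2 l) ∧ good (M1 l) (M2 l)) ∧
      (∀ l < L, τ (σ (M2 (l + 1)) + 1) + 2 ≤ σ (μ1 l) ∧ τ (μ1 l) < σ (μ2 l) ∧ μ2 l ≤ M1 l ∧ good (μ1 l) (μ2 l)) ∧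
      a₀ ≤ σ (M1 L) := by
  -- construction-indexed scales (`j = 0` innermost)
  have build : ∀ J : ℕ, ∃ A1 A2 ν1 ν2 : ℕ → ℕ,
      (∀ j ≤ J, 1 ≤ A1 j ∧ A1 j ≤ A2 j ∧ τ (A1 j) < σ (A2 j) ∧ good (A1 j) (A2 j)) ∧
      (∀ j < J, τ (σ (A2 j) + 1) + 2 ≤ σ (ν1 j) ∧ τ (ν1 j) < σ (ν2 j) ∧ ν2 j ≤ A1 (j + 1) ∧
        good (ν1 j) (ν2 j)) ∧
      a₀ ≤ σ (A1 0) := by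
    intro J
    induction J with
    | zero =>
      obtain ⟨b, hb, hb1, hαb⟩ := hgood (a₀ + 1) (τ (a₀ + 1) + 1)
      have h1 := hσ (a₀ + 1) (by omega)
      have h2 := hστ (a₀ + 1) (by omega)
      have h3 := hσ b hb1
      refine ⟨fun _ => a₀ + 1, fun _ => b, fun _ => 0, fun _ => 0, fun j hj => ?_,
        fun j hj => absurd hj (Nat.not_lt_zero _), ?_⟩
      · beta_reduce; exact ⟨by omega, by omega, by omega, hαb⟩
      · beta_reduce; omega
    | succ J ih =>
      obtain ⟨A1, A2, ν1, ν2, hA, hν, h0⟩ := ih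
      set c₁ : ℕ := τ (σ (A2 J) + 1) + 2 with hc₁
      obtain ⟨b1, hb1, hb11, hαb1⟩ := hgood c₁ (τ c₁ + 1)
      obtain ⟨b2, hb2, hb21, hαb2⟩ := hgood b1 (τ b1 + 1)
      have e1 := hσ c₁ (by omega)
      have e2 := hσ b1 hb11
      have e3 := hστ b1 hb11
      have e4 := hσ b2 hb21
      refine ⟨fun j => if j ≤ J then A1 j else b1, fun j => if j ≤ J then A2 j else b2,
        fun j => if j < J then ν1 j else c₁, fun j => if j < J then ν2 j else b1,
        fun j hj => ?_, fun j hj => ?_, by beta_reduce; rw [if_pos (Nat.zero_le J)]; exact h0⟩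
      · by_cases hjJ : j ≤ J
        · beta_reduce; rw [if_pos hjJ, if_pos hjJ]; exact hA j hjJ
        · beta_reduce; rw [if_neg hjJ, if_neg hjJ]
          exact ⟨hb11, by omega, by omega, hαb2⟩
      · by_cases hjJ : j < J
        · have h1 : j ≤ J := hjJ.le
          have h2 : j + 1 ≤ J := hjJ
          beta_reduce; rw [if_pos hjJ, if_pos hjJ, if_pos h1, if_pos h2]
          exact hν j hjJ
        · have hj' : j = J := by omega
          subst hj'
          beta_reduce
          rw [if_neg (lt_irrefl j), if_neg (lt_irrefl j), if_pos (le_refl j), if_neg (show ¬ (j + 1 ≤ j) from by omega)]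
          exact ⟨by omega, by omega, le_rfl, hαb1⟩
  obtain ⟨A1, A2, ν1, ν2, hA, hν, h0⟩ := build L
  refine ⟨fun l => A1 (L - l), fun l => A2 (L - l), fun l => ν1 (L - l - 1), fun l => ν2 (L - l - 1),
    fun l hl => hA (L - l) (by omega), fun l hl => ?_, by beta_reduce; rw [Nat.sub_self]; exact h0⟩
  have e1 : L - (l + 1) = L - l - 1 := by omega
  have e2 : L - l - 1 + 1 = L - l := by omega
  obtain ⟨h1, h2, h3, h4⟩ := hν (L - l - 1) (by omega)
  beta_reduce
  rw [e1]
  rw [e2] at h3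
  exact ⟨h1, h2, h3, h4⟩

end Summit.CriticalPhenomena.PercolationContinuityZ3.Theorems.Crossing

end
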